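import Summits.QuantumFields.YangMills.Theorems.BalabanUVNodesN11PartCompatOfCouplings

/-!
# DAG node N11 — THE RUN GUARD `PartCompat₁₃` FROM PRINT's TWO-SIDED RUNNING ([I] (0.31)): at a power-of-`L` basic cube `M = L^a` with (2.5)-exponent `r = 1`, the UPPER half of
# (0.31) — `1∕g_i² ≤ 1∕g² + β′·(K − i)·log L` along the run — and ONE top-level scalar `log(1∕g² + β′·log L) ≤ L^{m−a}` give `PartCompat₁₃ θ p n` for EVERY `n ≤ K`
# (log-log growth of `log g_i⁻²` in `K − i` against the exponential room `L^{K−i}`); at K1's witness of record θ₁₅ᶜᶜᴹᵂ(j; γ): `a = j`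

HEADER — WORK-UNIT METADATA.  Cell `pub-ymgap`, YM-PLAN Track A (HUMAN RULING D-0062 ∕ D-0149 width seats), seat `pub-ymgap-dag-n11-w4` (g3; WIDTH SEAT 4 of 4 on
NODE n11 [B14]), route `BalabanUVNodes`, item K1⁷ `StabilityBAtRecordR13SepCoPH` = stmt-QuantumFields-20542 (helper, `--kind proof --supports 20542 --as helper`, count-neutral).
[III] = [Balaban1988Convergent], [I] = [Balaban1987RG1].  Over this seat's `…N11PartCompatOfCouplings` (p608879: ★★★ `partCompat₁₃_iff_log_pow_le` — the guard IS the per-level scalar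
`(log g_i⁻²)^r ≤ L^{m+K−i−a}`; `partCompat₁₃_of_log_pow_le`; at θ₁₅ᶜᶜᴹᵂ `partCompat₁₃_theta13OfThm1CCMW_iff`), dag-n21-c's `Node00/Record13NumericsOfThm1CCMW` (`M = L^j`, `r = 1`).

WHY THIS FILE.  p608879 LOCATED the volume floor of the run guard and showed what a run must satisfy to be partition-compatible: `log g_i⁻² ≤ L^{m+K−i−a}` at every level.  The
one-sided window letter of the chain road (`(leavesP w p).smallCouplings` = `InInterval w.γ p.K`: `0 < g_k ≤ γ`) does NOT give it — it admits runs with `log g_K⁻² > L^{m−a}`.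
PRINT's run letter does: [I] (0.31), *«1∕g² + β log(L^k ε)⁻¹ ≤ 1∕g_k² ≤ 1∕g² + β′ log(L^k ε)⁻¹»* (typed as `Setup.LogRunning`), whose UPPER half caps `1∕g_i²` by
`1∕g² + β′·(K − i)·log L` (`ε = L^{−K}`), `g` the renormalised coupling (`g_K ≤ g`-side is the lower half, unused here).  THIS FILE proves: that upper half (stated on the record's own
couplings `gOfRecord₁₃ θ p`, so no `Flow` packaging is assumed), `0 < g`, `0 ≤ β′`, the room `a ≤ m` and the single top-level scalar `log(1∕g² + β′·log L) ≤ L^{m−a}` imply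
`PartCompat₁₃ θ p n` for every `n ≤ K`.  Arithmetic: `log g_i⁻² ≤ log(1∕g² + β′ d log L) ≤ log((1∕g² + β′ log L)(1 + d)) ≤ L^{m−a} + d ≤ L^{m−a}·L^{d} = L^{m+K−i−a}`
(`d = K − i`; `log(1+d) ≤ d`; `1 + d ≤ L^d`).  So, for the plan ∕ def-T: with (0.31) as the run letter the guard is a THEOREM given ONE volume-vs-coupling scalar; with the one-sided
window alone it is not (p608879) — the guard must then ride as an antecedent, as in def-T's record row `bg`.

WHAT THIS FILE PROVES (0 `sorry`, 0 `def`; nothing of Bałaban asserted — (0.31) enters as a HYPOTHESIS SHAPE on the record's couplings).  §1 arithmetic: `log_mul_one_add_le` ·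
`pow_add_ge_add` · `log_inv_sq_le_of_upperRunning`.  §2 generic θ (`θ.τ9.M = F.L^a`, `θ.ν.r = 1`): ★★ `partCompat₁₃_of_upperRunning`.  §3 at θ₁₅ᶜᶜᴹᵂ(j; γ) (`a = j`):
★★ `partCompat₁₃_theta13OfThm1CCMW_of_upperRunning`.

HONEST FRAMING.  Helper lane of K1⁷; elementary ℝ∕ℕ bookkeeping; nothing of [I]∕[III] asserted; NOT a discharge, NOT a refutation.  N11 NOT discharged; K1⁷ NOT closed; counts
unmoved (typed 28∕28 · discharged 5∕27).  R4 closes only the conditional finite-𝕋⁴ rung `BalabanLadder.UV` of one programme at fixed `ε = L^{−K}` — NOT ℝ⁴, NOT OS, NOT a mass gap,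
NOT Clay.  No `sorry`, `axiom`, `def`, `instance`, `notation`.  Sources (SHAPE only): [I] (0.31) p.259, (0.1) p.251; [III] (2.1) p.254, (2.5) p.255, p.257.
-/

noncomputable section

namespace Summit.QuantumFields.YangMills.Theorems.BalabanUVNodesN11PartCompatOfTwoSidedRunning

open Literature.MathematicalPhysics.QuantumFieldTheory.Balaban1983to89 T4Continuum Node00
open BalabanUVNodesN11PartCompatOfCouplings (partCompat₁₃_of_log_pow_le)

/-! ## §1  Arithmetic: log-log growth against exponential room -/

section Arith

/-- `log(X·(1+d)) ≤ log X + d` for `X > 0`, `d ≥ 0` (`log(1+d) ≤ d`). [cite: Balaban1987RG1, (0.31) p.259 (elementary)] -/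
theorem log_mul_one_add_le {X d : ℝ} (hX : 0 < X) (hd : 0 ≤ d) : Real.log (X * (1 + d)) ≤ Real.log X + d := by
  rw [Real.log_mul hX.ne' (by linarith)]
  have h := Real.log_le_sub_one_of_pos (show 0 < 1 + d by linarith)
  linarith

/-- `L^e + d ≤ L^e · L^d` for `L ≥ 2` (`1 + d ≤ L^d`, `1 ≤ L^e`). [cite: Balaban1987RG1, (0.1) p.251 (elementary)] -/
theorem pow_add_ge_add {L : ℕ} (hL : 2 ≤ L) (e d : ℕ) : ((L ^ e : ℕ) : ℝ) + d ≤ ((L ^ e * L ^ d : ℕ) : ℝ) := by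
  have h1 : 1 + d ≤ L ^ d := by
    have h2d : d < 2 ^ d := Nat.lt_two_pow_self
    calc 1 + d ≤ 2 ^ d := by omega
      _ ≤ L ^ d := Nat.pow_le_pow_left hL d
  have h2 : 1 ≤ L ^ e := Nat.one_le_pow _ _ (by omega)
  have h3 : L ^ e + d ≤ L ^ e * L ^ d := by
    calc L ^ e + d ≤ L ^ e + L ^ e * d := by nlinarith
      _ = L ^ e * (1 + d) := by ring
      _ ≤ L ^ e * L ^ d := Nat.mul_le_mul_left _ h1
  exact_mod_cast h3

/-- **THE UPPER HALF OF (0.31) CAPS `log g_i⁻²`**: `0 < g_i`, `1∕g_i² ≤ 1∕g² + β′·d·log L` (`0 < g`, `0 ≤ β′`, `1 ≤ L`, `d ≥ 0`) ⇒ `log g_i⁻² ≤ log(1∕g² + β′·log L) + d`.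
[cite: Balaban1987RG1, (0.31) p.259] -/
theorem log_inv_sq_le_of_upperRunning {gi g β' d L : ℝ} (hgi : 0 < gi) (hg : 0 < g) (hβ : 0 ≤ β') (hL : 1 ≤ L) (hd : 0 ≤ d)
    (h : 1 / gi ^ 2 ≤ 1 / g ^ 2 + β' * d * Real.log L) :
    Real.log (gi ^ 2)⁻¹ ≤ Real.log (1 / g ^ 2 + β' * Real.log L) + d := by
  have hlogL : 0 ≤ Real.log L := Real.log_nonneg hL
  have hX : 0 < 1 / g ^ 2 + β' * Real.log L := by positivity
  have hgi2 : 0 < (gi ^ 2)⁻¹ := by positivity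
  have h1 : (gi ^ 2)⁻¹ ≤ (1 / g ^ 2 + β' * Real.log L) * (1 + d) := by
    rw [← one_div]
    have h2 : 1 / g ^ 2 + β' * d * Real.log L ≤ (1 / g ^ 2 + β' * Real.log L) * (1 + d) := by
      have : 0 ≤ 1 / g ^ 2 * d := by positivity
      nlinarith
    exact h.trans h2
  calc Real.log (gi ^ 2)⁻¹ ≤ Real.log ((1 / g ^ 2 + β' * Real.log L) * (1 + d)) := Real.log_le_log hgi2 h1
    _ ≤ Real.log (1 / g ^ 2 + β' * Real.log L) + d := log_mul_one_add_le hX hd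

end Arith

/-! ## §2  `PartCompat₁₃` at `M = L^a`, `r = 1`, from the upper half of (0.31) and one top-level scalar -/

section Generic

variable {F : T4Family} {N : ℕ} [NeZero N]

/-- **★★ THE RUN GUARD FROM PRINT's TWO-SIDED RUNNING** (upper half of [I] (0.31) on the record's couplings): at `θ.τ9.M = F.L^a`, `θ.ν.r = 1`, if `0 < g`, `0 ≤ β′`,
`1∕g_i² ≤ 1∕g² + β′·(K − i)·log L` and `0 < g_i` for `i ≤ K`, the room `a ≤ F.m` and `log(1∕g² + β′·log L) ≤ L^{m−a}`, then the run is partition-compatible up to every `n ≤ K`.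
[cite: Balaban1987RG1, (0.31) p.259, (0.1) p.251; Balaban1988Convergent, (2.1) p.254, (2.5) p.255, p.257] -/
theorem partCompat₁₃_of_upperRunning (θ : Stage13Params F N) {a : ℕ} (hM : θ.τ9.M = F.L ^ a) (hr : θ.ν.r = 1) (p : B12.RunParams)
    (ha : a ≤ F.m) {g β' : ℝ} (hg : 0 < g) (hβ : 0 ≤ β')
    (hrun : ∀ i, i ≤ p.K → 0 < gOfRecord₁₃ F N θ p i ∧
      1 / gOfRecord₁₃ F N θ p i ^ 2 ≤ 1 / g ^ 2 + β' * ((p.K - i : ℕ) : ℝ) * Real.log F.L)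
    (htop : Real.log (1 / g ^ 2 + β' * Real.log F.L) ≤ ((F.L ^ (F.m - a) : ℕ) : ℝ))
    {n : ℕ} (hn : n ≤ p.K) : PartCompat₁₃ F N θ p n := by
  have hL2 : 2 ≤ F.L := by have := F.hL11; omega
  have hL1 : (1 : ℝ) ≤ F.L := by exact_mod_cast (by omega : 1 ≤ F.L)
  refine partCompat₁₃_of_log_pow_le θ hM p n (fun i => F.m + p.K - i - a) (fun i _ hi => by omega) fun i h1 hi => ?_
  rw [hr, pow_one]
  obtain ⟨hgi, hle⟩ := hrun i (hi.trans hn)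
  have hstep := log_inv_sq_le_of_upperRunning hgi hg hβ hL1 (Nat.cast_nonneg (p.K - i)) hle
  have hexp : F.m + p.K - i - a = (F.m - a) + (p.K - i) := by omega
  calc Real.log (gOfRecord₁₃ F N θ p i ^ 2)⁻¹
      ≤ Real.log (1 / g ^ 2 + β' * Real.log F.L) + ((p.K - i : ℕ) : ℝ) := hstep
    _ ≤ ((F.L ^ (F.m - a) : ℕ) : ℝ) + ((p.K - i : ℕ) : ℝ) := by linarith
    _ ≤ ((F.L ^ (F.m - a) * F.L ^ (p.K - i) : ℕ) : ℝ) := pow_add_ge_add hL2 _ _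
    _ = ((F.L ^ (F.m + p.K - i - a) : ℕ) : ℝ) := by rw [hexp, pow_add]

end Generic

/-! ## §3  At K1's witness of record `θ₁₅ᶜᶜᴹᵂ(j; γ)` (`M = L^j`, `r = 1`) -/

section Witness

variable (F : T4Family) (N : ℕ) [NeZero N] (j : ℕ) (γ ε₀ ε₂₉ B₃ B₃' a₀ a₁ : ℝ)

/-- **★★ THE RUN GUARD AT θ₁₅ᶜᶜᴹᵂ(j; γ) FROM THE UPPER HALF OF (0.31)**: `j ≤ F.m`, `0 < g`, `0 ≤ β′`, `1∕g_i² ≤ 1∕g² + β′·(K − i)·log L` (`0 < g_i`, `i ≤ K`) and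
`log(1∕g² + β′·log L) ≤ L^{m−j}` ⇒ `PartCompat₁₃ θ₁₅ᶜᶜᴹᵂ p n` for every `n ≤ K`. [cite: Balaban1987RG1, (0.31) p.259; Balaban1988Convergent, (2.1) p.254, (2.5) p.255, p.257; Balaban1989LargeFieldI, (2.1) p.182] -/
theorem partCompat₁₃_theta13OfThm1CCMW_of_upperRunning (p : B12.RunParams) (hj : j ≤ F.m) {g β' : ℝ} (hg : 0 < g) (hβ : 0 ≤ β')
    (hrun : ∀ i, i ≤ p.K → 0 < gOfRecord₁₃ F N (theta13OfThm1CCMW F N j γ ε₀ ε₂₉ B₃ B₃' a₀ a₁) p i ∧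
      1 / gOfRecord₁₃ F N (theta13OfThm1CCMW F N j γ ε₀ ε₂₉ B₃ B₃' a₀ a₁) p i ^ 2 ≤ 1 / g ^ 2 + β' * ((p.K - i : ℕ) : ℝ) * Real.log F.L)
    (htop : Real.log (1 / g ^ 2 + β' * Real.log F.L) ≤ ((F.L ^ (F.m - j) : ℕ) : ℝ))
    {n : ℕ} (hn : n ≤ p.K) : PartCompat₁₃ F N (theta13OfThm1CCMW F N j γ ε₀ ε₂₉ B₃ B₃' a₀ a₁) p n :=
  partCompat₁₃_of_upperRunning (theta13OfThm1CCMW F N j γ ε₀ ε₂₉ B₃ B₃' a₀ a₁)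
    (theta13OfThm1CCMW_τ9_M F N j γ ε₀ ε₂₉ B₃ B₃' a₀ a₁) (theta13OfThm1CCMW_r F N j γ ε₀ ε₂₉ B₃ B₃' a₀ a₁) p hj hg hβ hrun htop hn

end Witness

end Summit.QuantumFields.YangMills.Theorems.BalabanUVNodesN11PartCompatOfTwoSidedRunning

end
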